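import Summits.AtomisticToContinuum.HydrodynamicLimit.Theorems.ImplosionDichotomyPolynomialCompressionUniquenessPrimitive

/-!
# Transport and symmetric-flux identities in the torus space–time calculus

Helper file for the line `log-lipschitz-budget` of the crux
`ImplosionDichotomy.PolynomialCompression` (stub `stub_logBudgetShadowing`: the `H³` energy method
between a hard-sphere Euler solution and the reference implosion). At every derivative level
`k = 0, …, 3` and for every component of the symmetrised system the energy density is a weighted
square `w X²` (weight `w ∈ {A, ρ, B}`, `X = ∂^α` of a component of the difference), and the two
pieces of pointwise Leibniz bookkeeping that are used over and over again are proved here ONCE,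
in the calculus of `Literature.Analysis.FunctionSpaces.TorusCalculus`
(`∂ₜ := Torus.timeDerivWithin (Ico 0 T)`, the one-sided time derivative within `[0, T)`;
`∂ᵢ := Torus.partialDeriv i`; `D_t f := ∂ₜf + Σᵢ uᵢ ∂ᵢf`):

* `torus_transport_energy_identity` — for jointly smooth scalar fields `w, X` and a jointly smooth
  velocity field `u` on `[0, T) × 𝕋³`,
  `∂ₜ(w X²) + Σᵢ ∂ᵢ(w X² uᵢ) = (D_t w + w div u) X² + 2 w X D_t X`;
* `torus_transport_energy_identity_norm_sq` — the same for a vector-valued `X` (values in a real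
  inner product space `E`),
  `∂ₜ(w ‖X‖²) + Σᵢ ∂ᵢ(w ‖X‖² uᵢ) = (D_t w + w div u) ‖X‖² + 2 w ⟪X, D_t X⟫`;
* `torus_symm_flux_identity` — for `C¹` scalar functions `c, X, Y` on `𝕋³` (e.g. time slices),
  `∂ᵢ(c X Y) = (∂ᵢc) X Y + c (∂ᵢX · Y + X · ∂ᵢY)`, i.e. the acoustic cross terms
  `c (∂ᵢX · Y + X · ∂ᵢY)` of a symmetrised first-order system are a divergence up to `-(∂ᵢc) X Y`.

All three are stated in the `∀`-form of their registered signatures (binders after the colon).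
Proofs: product rules along coordinate lines (`hasDerivAt_coordLine`,
`Torus.hasDerivAt_comp_add_proj_smul`) and along time slices
(`Torus.IsSmoothSpaceTimeOn.hasDerivWithinAt_slice`, uniqueness of one-sided derivatives on
`Ico 0 T` via `uniqueDiffOn_Ico`), closed by `ring`. Nothing about the Euler system is used here.
-/

noncomputable section

namespace Summit.AtomisticToContinuum.HydrodynamicLimit.Theorems

open Set Filter Topology MeasureTheory
open scoped ContDiff InnerProductSpace
open Literature.MathematicalPhysics.KineticTheory Literature.Analysis.FunctionSpaces

/-- **Symmetric flux identity.** For `C¹` scalar functions `c, X, Y` on `𝕋³`, `i : Fin 3` and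
`x ∈ 𝕋³`, `∂ᵢ(c X Y)(x) = ∂ᵢc(x) X(x) Y(x) + c(x) (∂ᵢX(x) Y(x) + X(x) ∂ᵢY(x))`: the cross terms
`c (∂ᵢX · Y + X · ∂ᵢY)` of a symmetrised first-order system are a divergence up to the
zero-order term `-(∂ᵢc) X Y`. [folklore] -/
theorem torus_symm_flux_identity :
    ∀ {c X Y : T3 → ℝ}, Torus.IsContDiff 1 c → Torus.IsContDiff 1 X → Torus.IsContDiff 1 Y →
      ∀ (i : Fin 3) (x : T3),
        Torus.partialDeriv i (fun y => c y * X y * Y y) x =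
          Torus.partialDeriv i c x * X x * Y x +
            c x * (Torus.partialDeriv i X x * Y x + X x * Torus.partialDeriv i Y x) := by
  intro c X Y hc hX hY i x
  exact partialDeriv_eq_of_hasDerivAt ((((hasDerivAt_coordLine hc x i).fun_mul
    (hasDerivAt_coordLine hX x i)).fun_mul (hasDerivAt_coordLine hY x i)).congr_deriv
    (by simp only [zero_smul, Torus.proj_zero, add_zero]; ring))

/-- **Transport energy identity (scalar).** For jointly smooth scalar fields `w, X` and a jointly
smooth velocity field `u` on `[0, T) × 𝕋³`, at every `t ∈ [0, T)` and `x ∈ 𝕋³`,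
`∂ₜ(w X²) + Σᵢ ∂ᵢ(w X² uᵢ) = (∂ₜw + Σᵢ uᵢ ∂ᵢw + w Σᵢ ∂ᵢuᵢ) X² + 2 w X (∂ₜX + Σᵢ uᵢ ∂ᵢX)`, i.e.
`∂ₜe + div(e u) = (D_t w + w div u) X² + 2 w X D_t X` for the weighted square `e = w X²`
(`∂ₜ` the one-sided time derivative within `Ico 0 T`). [folklore] -/
theorem torus_transport_energy_identity :
    ∀ {T : ℝ} {w X : ℝ → T3 → ℝ} {u : ℝ → T3 → V3},
      Torus.IsSmoothSpaceTimeOn (Ico 0 T) w → Torus.IsSmoothSpaceTimeOn (Ico 0 T) X →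
      Torus.IsSmoothSpaceTimeOn (Ico 0 T) u → ∀ {t : ℝ}, t ∈ Ico 0 T → ∀ x : T3,
        Torus.timeDerivWithin (Ico 0 T) (fun s y => w s y * X s y ^ 2) t x +
            ∑ i, Torus.partialDeriv i (fun y => w t y * X t y ^ 2 * u t y i) x =
          (Torus.timeDerivWithin (Ico 0 T) w t x + ∑ i, u t x i * Torus.partialDeriv i (w t) x +
                w t x * ∑ i, Torus.partialDeriv i (fun y => u t y i) x) * X t x ^ 2 +
            2 * w t x * X t x * (Torus.timeDerivWithin (Ico 0 T) X t x +
              ∑ i, u t x i * Torus.partialDeriv i (X t) x) := by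
  intro T w X u hw hX hu t ht x
  have hU : UniqueDiffOn ℝ (Ico (0 : ℝ) T) := uniqueDiffOn_Ico 0 T
  have hw1 : Torus.IsContDiff 1 (w t) := (hw.isSmooth_slice ht).isContDiff (by simp)
  have hX1 : Torus.IsContDiff 1 (X t) := (hX.isSmooth_slice ht).isContDiff (by simp)
  have hu1 : Torus.IsContDiff 1 (u t) := (hu.isSmooth_slice ht).isContDiff (by simp)
  have huj1 : ∀ i, Torus.IsContDiff 1 (fun y => u t y i) := fun i => isContDiff_apply_coord hu1 i
  -- (1) the one-sided time derivative of `w X²`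
  rw [timeDerivWithin_eq_of_hasDerivWithinAt ((hw.hasDerivWithinAt_slice ht x).fun_mul
    ((hX.hasDerivWithinAt_slice ht x).fun_pow 2)) (hU t ht)]
  -- (2) the divergence of the flux `w X² uᵢ`, coordinate by coordinate
  have hΦ : ∀ i, Torus.partialDeriv i (fun y => w t y * X t y ^ 2 * u t y i) x =
      (Torus.partialDeriv i (w t) x * X t x ^ 2 +
          w t x * (2 * X t x * Torus.partialDeriv i (X t) x)) * u t x i +
        w t x * X t x ^ 2 * Torus.partialDeriv i (fun y => u t y i) x := by
    intro i
    exact partialDeriv_eq_of_hasDerivAt ((((hasDerivAt_coordLine hw1 x i).fun_mul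
      ((hasDerivAt_coordLine hX1 x i).fun_pow 2)).fun_mul
      (hasDerivAt_coordLine (huj1 i) x i)).congr_deriv
      (by simp only [zero_smul, Torus.proj_zero, add_zero]; ring))
  simp only [hΦ, Fin.sum_univ_three]
  ring

/-- **Transport energy identity (vector-valued).** For a jointly smooth scalar weight `w`, a
jointly smooth field `X` with values in a real inner product space `E` and a jointly smooth
velocity field `u` on `[0, T) × 𝕋³`, at every `t ∈ [0, T)` and `x ∈ 𝕋³`,
`∂ₜ(w ‖X‖²) + Σᵢ ∂ᵢ(w ‖X‖² uᵢ) = (∂ₜw + Σᵢ uᵢ ∂ᵢw + w Σᵢ ∂ᵢuᵢ) ‖X‖² + 2 w ⟪X, ∂ₜX + Σᵢ uᵢ ∂ᵢX⟫`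
(`∂ₜ` the one-sided time derivative within `Ico 0 T`). [folklore] -/
theorem torus_transport_energy_identity_norm_sq :
    ∀ {T : ℝ} {E : Type} [NormedAddCommGroup E] [InnerProductSpace ℝ E] {w : ℝ → T3 → ℝ}
      {X : ℝ → T3 → E} {u : ℝ → T3 → V3},
      Torus.IsSmoothSpaceTimeOn (Ico 0 T) w → Torus.IsSmoothSpaceTimeOn (Ico 0 T) X →
      Torus.IsSmoothSpaceTimeOn (Ico 0 T) u → ∀ {t : ℝ}, t ∈ Ico 0 T → ∀ x : T3,
        Torus.timeDerivWithin (Ico 0 T) (fun s y => w s y * ‖X s y‖ ^ 2) t x +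
            ∑ i, Torus.partialDeriv i (fun y => w t y * ‖X t y‖ ^ 2 * u t y i) x =
          (Torus.timeDerivWithin (Ico 0 T) w t x + ∑ i, u t x i * Torus.partialDeriv i (w t) x +
                w t x * ∑ i, Torus.partialDeriv i (fun y => u t y i) x) * ‖X t x‖ ^ 2 +
            2 * w t x * inner ℝ (X t x) (Torus.timeDerivWithin (Ico 0 T) X t x +
              ∑ i, u t x i • Torus.partialDeriv i (X t) x) := by
  intro T E _ _ w X u hw hX hu t ht x
  have hU : UniqueDiffOn ℝ (Ico (0 : ℝ) T) := uniqueDiffOn_Ico 0 T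
  have hw1 : Torus.IsContDiff 1 (w t) := (hw.isSmooth_slice ht).isContDiff (by simp)
  have hX1 : Torus.IsContDiff 1 (X t) := (hX.isSmooth_slice ht).isContDiff (by simp)
  have hu1 : Torus.IsContDiff 1 (u t) := (hu.isSmooth_slice ht).isContDiff (by simp)
  have huj1 : ∀ i, Torus.IsContDiff 1 (fun y => u t y i) := fun i => isContDiff_apply_coord hu1 i
  -- the vector field `X t` along coordinate lines (vector-valued `hasDerivAt_coordLine`)
  have cX : ∀ i : Fin 3, HasDerivAt
      (fun s : ℝ => X t (x + Torus.proj (s • EuclideanSpace.single i (1 : ℝ))))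
      (Torus.partialDeriv i (X t) x) 0 := fun i => by
    have h := Torus.hasDerivAt_comp_add_proj_smul hX1 x (EuclideanSpace.single i (1 : ℝ)) 0
    simp only [zero_smul, Torus.proj_zero, add_zero] at h
    exact h
  -- (1) the one-sided time derivative of `w ‖X‖²`
  rw [timeDerivWithin_eq_of_hasDerivWithinAt ((hw.hasDerivWithinAt_slice ht x).fun_mul
    (hX.hasDerivWithinAt_slice ht x).norm_sq) (hU t ht)]
  -- (2) the divergence of the flux `w ‖X‖² uᵢ`, coordinate by coordinate
  have hΦ : ∀ i, Torus.partialDeriv i (fun y => w t y * ‖X t y‖ ^ 2 * u t y i) x =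
      (Torus.partialDeriv i (w t) x * ‖X t x‖ ^ 2 +
          w t x * (2 * ⟪X t x, Torus.partialDeriv i (X t) x⟫_ℝ)) * u t x i +
        w t x * ‖X t x‖ ^ 2 * Torus.partialDeriv i (fun y => u t y i) x := by
    intro i
    exact partialDeriv_eq_of_hasDerivAt ((((hasDerivAt_coordLine hw1 x i).fun_mul
      (cX i).norm_sq).fun_mul (hasDerivAt_coordLine (huj1 i) x i)).congr_deriv
      (by simp only [zero_smul, Torus.proj_zero, add_zero]))
  simp only [hΦ, Fin.sum_univ_three, inner_add_right, inner_smul_right]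
  ring

end Summit.AtomisticToContinuum.HydrodynamicLimit.Theorems

end
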